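import Summits.BirchSwinnertonDyer.Rank1Residual.F1Sign2.HeegnerCuspSymbolAtTwo
import Summits.BirchSwinnertonDyer.Rank1Residual.F1Sign2.TwistPeriodUnitCanonicalProofs
import HarnessLib

/-!
# Route ByReductionTypeAtTwo, crux `RankOneAtTwoBigImageOddLocal` (stmt-BirchSwinnertonDyer-23715), LINE `one_door_analytic` (R⁺₀ side, -an's AN-34 glue):
# AN-34l″ / AN-34l′ ARE THEOREMS — the minus PERIOD unit of a rational newform is exactly `½`

Width prover seat `bsd-line-fkl-p2` g14 (2026-08-28), `--supports stmt-BirchSwinnertonDyer-23715` (helper).  THEOREMS ONLY (no definition, no named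
fact introduced, no `sorry`); UNCONDITIONAL (the Eichler–Shimura / Manin facts used are tree theorems `…_holds`).  BSD is not proved by any of this.

-an g17's glue v50 `EtaOneReductionAtTwo` (`g17/Sketch_v50.lean` §20.5) consumes AN-34l′ `MinusPeriodUnitEqHalf` («∀ rational newform `f`, every minus
period unit `u` of `f` equals `½`»); REF1 §145 asked for the EXISTENCE form AN-34l″ `MinusPeriodUnitIsHalf` («`½` IS a minus period unit»), from which AN-34l′
follows by uniqueness.  Both are proved here, with the bodies VERBATIM as the types of `minusPeriodUnitIsHalf` and `minusPeriodUnitEqHalf` (once the typer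
files the `def`s, `_holds` is `exact` these).

Mechanism (REF1 §145's words-proof).  `IsMinusPeriodUnit f u` (tree, `F1Sign2/HeegnerCuspSymbolAtTwo.lean` §20.3): `u > 0`, every AXIS cusp symbol
`[−a/(Nb)]⁻_f` (`b ≠ 0`, `gcd(a, Nb) = 1`) is an integer multiple of `u`, and `u` is the largest such.  (i) `[−a/(Nb)]⁻_f ∈ ½ℤ`: `−a/(Nb) = γ∞` for
`γ = (a v; −Nb w) ∈ Γ₀(N)` (`a w + N b v = 1`), so `{∞, −a/(Nb)}_f = cuspSymbol f γ ∈ Λ_f` (`cuspSymbol_mem_periodLattice`) and `im Λ_f = ℤ·Ω⁻_f/2`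
(`minusPeriod_eq_zero_or`), `im{∞,r} = [r]⁻·Ω⁻` (`im_modularSymbol_eq`).  (ii) maximality: conversely EVERY generator `cuspSymbol f γ` of `Λ_f` is `0`
(lower-left entry `0`) or an axis cusp symbol (lower-left entry `−N b`, `b ≠ 0`, coprimality from `det γ = 1`), so if all axis symbols lie in `u′ℤ` then
(closure induction) `im Λ_f ⊆ u′Ω⁻ℤ`; as `Ω⁻/2 ∈ im Λ_f`, `½ = z u′` with `z ≥ 1`, i.e. `u′ ≤ ½`.

* §1 `exists_int_ratMinusSymbol_axisCusp_eq_div_two` (every axis cusp symbol is in `½ℤ`), `im_eq_zsmul_of_axis_unit` (closure induction), `le_half_of_axis_unit`,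
  `isMinusPeriodUnit_unique`;
* §2 **`minusPeriodUnitIsHalf`** (AN-34l″) and **`minusPeriodUnitEqHalf`** (AN-34l′).

References: [Manin1972] Prop. 1.4, Thm. 1.6, 1.9; [CremonaAlgorithms1997] §2.8; [MazurTateTeitelbaum1986Invent] §I.8.
-/

set_option autoImplicit false
-- the Theorems namespace of this sub repeats the summit name by design (D-0017 nested layout)
set_option linter.dupNamespace false

noncomputable section

open scoped Classical MatrixGroups ModularForm

namespace Summit.BirchSwinnertonDyer.BirchSwinnertonDyer.Theorems.RankOneAtTwoOneDoor

open CongruenceSubgroup Literature.NumberTheory.EllipticCurves Literature.NumberTheory.EllipticCurves.ModularForms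
  Summit.BirchSwinnertonDyer.Rank1Residual.F1Sign2 Summit.BirchSwinnertonDyer.Rank1Residual.F1Sign2.ANg16
  Summit.BirchSwinnertonDyer.Rank1Residual.F1Sign2.ANg17

/-! ### §1 Axis cusp symbols lie in `½ℤ`, and they generate `im Λ_f / Ω⁻` -/

/-- **Every AXIS cusp symbol of a rational newform lies in `½ℤ`**: for `b ≠ 0` and `gcd(a, Nb) = 1`, `[−a/(Nb)]⁻_f = z/2`.  With `w a + v (N b) = 1` the matrix
`γ = (a, v; −N b, w)` lies in `Γ₀(N)` and `γ∞ = −a/(Nb)`, so `{∞, −a/(Nb)}_f = cuspSymbol f γ ∈ Λ_f` and its imaginary part lies in `im Λ_f = ℤ·Ω⁻_f/2`;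
`im {∞, r}_f = [r]⁻_f · Ω⁻_f`.  (The tree's `exists_int_ratMinusSymbol_eq_div_two` is the complementary case of denominators COPRIME to `N`.)
[cite: Manin1972, Prop. 1.4] [cite: CremonaAlgorithms1997, §2.8] -/
theorem exists_int_ratMinusSymbol_axisCusp_eq_div_two {N : ℕ} [NeZero N] {f : CuspForm (Gamma0 N) 2} (hf : IsNewform0 f) (hQ : coeffField f = ⊥)
    {a b : ℤ} (hb : b ≠ 0) (hab : IsCoprime a ((N : ℤ) * b)) : ∃ z : ℤ, ratMinusSymbol f (axisCusp N a b) = (z : ℚ) / 2 := by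
  have hNz : (N : ℤ) ≠ 0 := by exact_mod_cast (NeZero.ne N)
  have hpos : 0 < minusPeriod f := IsNewform0.minusPeriod_pos_holds hf hQ
  have him : imagPeriods f = AddSubgroup.zmultiples (minusPeriod f / 2) := by
    rcases minusPeriod_eq_zero_or f with h | ⟨-, h⟩
    · exact absurd h hpos.ne'
    · exact h
  obtain ⟨w, v, hwv⟩ := hab
  -- γ = (a, v; -N b, w) ∈ Γ₀(N), γ∞ = -a/(N b)
  have hdet : Matrix.det !![a, v; -((N : ℤ) * b), w] = 1 := by
    rw [Matrix.det_fin_two_of]; linear_combination hwv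
  set g : SL(2, ℤ) := ⟨!![a, v; -((N : ℤ) * b), w], hdet⟩ with hg_def
  have h00 : (g 0 0 : ℤ) = a := rfl
  have h10 : (g 1 0 : ℤ) = -((N : ℤ) * b) := rfl
  have hg : g ∈ Gamma0 N := by
    rw [Gamma0_mem, h10]; push_cast; simp
  set γ : Gamma0 N := ⟨g, hg⟩ with hγ_def
  have hcusp : cuspSymbol f γ = modularSymbol f (axisCusp N a b) := by
    have h10' : ¬ ((γ : SL(2, ℤ)) 1 0 : ℤ) = 0 := by
      show ¬ (g 1 0 : ℤ) = 0
      rw [h10]; exact neg_ne_zero.mpr (mul_ne_zero hNz hb)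
    rw [cuspSymbol, if_neg h10']
    show modularSymbol f (((g 0 0 : ℤ) : ℚ) / ((g 1 0 : ℤ) : ℚ)) = _
    rw [h00, h10, axisCusp]
    push_cast
    rw [div_neg, neg_div]
  -- its imaginary part is a period imaginary part
  have hmemΛ : cuspSymbol f γ ∈ periodLattice f := cuspSymbol_mem_periodLattice f _
  have hmem : (modularSymbol f (axisCusp N a b)).im ∈ imagPeriods f := by
    rw [← hcusp]
    unfold imagPeriods
    exact AddSubgroup.mem_map.mpr ⟨_, hmemΛ, rfl⟩
  rw [him] at hmem
  obtain ⟨k, hk⟩ := AddSubgroup.mem_zmultiples_iff.mp hmem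
  refine ⟨k, ?_⟩
  have h3 : ((ratMinusSymbol f (axisCusp N a b) : ℚ) : ℝ) * minusPeriod f = ((k : ℝ) / 2) * minusPeriod f := by
    rw [← im_modularSymbol_eq hf hQ, ← hk, zsmul_eq_mul]
    ring
  have h4 := mul_right_cancel₀ hpos.ne' h3
  have h5 : ((ratMinusSymbol f (axisCusp N a b) : ℚ) : ℝ) = (((k : ℚ) / 2 : ℚ) : ℝ) := by push_cast; linarith [h4]
  exact Rat.cast_injective h5

/-- **The axis cusp symbols GENERATE `im Λ_f` (closure induction)**: if every axis cusp symbol `[−a/(Nb)]⁻_f` (`b ≠ 0`, `gcd(a, Nb) = 1`) is an integer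
multiple of `u′`, then the imaginary part of every element of the period lattice `Λ_f = ⟨cuspSymbol f γ : γ ∈ Γ₀(N)⟩` is an integer multiple of `u′·Ω⁻_f`:
a generator `cuspSymbol f γ` is `0` when `γ`'s lower-left entry vanishes, and otherwise that entry is `N b` with `b ≠ 0` and `cuspSymbol f γ = {∞, −(−γ₀₀)/(Nb)}_f`
is an axis cusp symbol (`gcd(γ₀₀, γ₁₀) = 1` from `det γ = 1`). [cite: Manin1972, Prop. 1.4 and Thm. 1.9] [cite: CremonaAlgorithms1997, §2.8] -/
theorem im_eq_zsmul_of_axis_unit {N : ℕ} [NeZero N] {f : CuspForm (Gamma0 N) 2} (hf : IsNewform0 f) (hQ : coeffField f = ⊥) {u' : ℚ}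
    (hu' : ∀ a b : ℤ, b ≠ 0 → IsCoprime a ((N : ℤ) * b) → ∃ z : ℤ, ratMinusSymbol f (axisCusp N a b) = z * u')
    {x : ℂ} (hx : x ∈ periodLattice f) : ∃ z : ℤ, x.im = (z : ℝ) * ((u' : ℝ) * minusPeriod f) := by
  unfold periodLattice at hx
  refine AddSubgroup.closure_induction (fun y hy => ?_) ⟨0, by simp⟩ (fun x y _ _ ihx ihy => ?_) (fun x _ ihx => ?_) hx
  · obtain ⟨γ, rfl⟩ := hy
    by_cases h10 : ((γ : SL(2, ℤ)) 1 0 : ℤ) = 0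
    · refine ⟨0, ?_⟩
      rw [cuspSymbol, if_pos h10]
      simp
    · -- lower-left entry `= N * b₀` with `b₀ ≠ 0`; the cusp is the axis cusp of `(-γ₀₀, b₀)`
      have hdvd : (N : ℤ) ∣ ((γ : SL(2, ℤ)) 1 0 : ℤ) := by
        have hmem := γ.2
        rw [Gamma0_mem] at hmem
        exact (ZMod.intCast_zmod_eq_zero_iff_dvd _ N).mp hmem
      obtain ⟨b₀, hb₀⟩ := hdvd
      have hb₀ne : b₀ ≠ 0 := by
        rintro rfl
        exact h10 (by rw [hb₀, mul_zero])
      have hdet : ((γ : SL(2, ℤ)) 0 0 : ℤ) * ((γ : SL(2, ℤ)) 1 1 : ℤ) - ((γ : SL(2, ℤ)) 0 1 : ℤ) * ((γ : SL(2, ℤ)) 1 0 : ℤ) = 1 := by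
        have h := Matrix.SpecialLinearGroup.det_coe (γ : SL(2, ℤ))
        rw [Matrix.det_fin_two] at h
        exact h
      have hcop : IsCoprime (-((γ : SL(2, ℤ)) 0 0 : ℤ)) ((N : ℤ) * b₀) := by
        rw [← hb₀]
        exact ⟨-((γ : SL(2, ℤ)) 1 1 : ℤ), -((γ : SL(2, ℤ)) 0 1 : ℤ), by linear_combination hdet⟩
      obtain ⟨z, hz⟩ := hu' _ _ hb₀ne hcop
      have hN0 : (N : ℚ) ≠ 0 := by exact_mod_cast (NeZero.ne N)
      have hb₀Q : (b₀ : ℚ) ≠ 0 := by exact_mod_cast hb₀ne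
      have hq : (((γ : SL(2, ℤ)) 0 0 : ℤ) : ℚ) / (((γ : SL(2, ℤ)) 1 0 : ℤ) : ℚ) = axisCusp N (-((γ : SL(2, ℤ)) 0 0 : ℤ)) b₀ := by
        rw [axisCusp, hb₀]
        push_cast
        field_simp
      have hcusp : cuspSymbol f γ = modularSymbol f (axisCusp N (-((γ : SL(2, ℤ)) 0 0 : ℤ)) b₀) := by
        rw [cuspSymbol, if_neg h10, hq]
      refine ⟨z, ?_⟩
      rw [hcusp, im_modularSymbol_eq hf hQ, hz]
      push_cast
      ring
  · obtain ⟨z₁, h₁⟩ := ihx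
    obtain ⟨z₂, h₂⟩ := ihy
    exact ⟨z₁ + z₂, by rw [Complex.add_im, h₁, h₂]; push_cast; ring⟩
  · obtain ⟨z, h⟩ := ihx
    exact ⟨-z, by rw [Complex.neg_im, h]; push_cast; ring⟩

/-- **Maximality: any common divisor `u′ > 0` of the axis cusp symbols is `≤ ½`** (rational newform): `Ω⁻/2 ∈ im Λ_f` (`minusPeriod_eq_zero_or`) is
`z·u′·Ω⁻` by the closure induction, so `½ = z u′` with `z ≥ 1`. [cite: CremonaAlgorithms1997, §2.8] -/
theorem le_half_of_axis_unit {N : ℕ} [NeZero N] {f : CuspForm (Gamma0 N) 2} (hf : IsNewform0 f) (hQ : coeffField f = ⊥) {u' : ℚ} (hu'pos : 0 < u')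
    (hu' : ∀ a b : ℤ, b ≠ 0 → IsCoprime a ((N : ℤ) * b) → ∃ z : ℤ, ratMinusSymbol f (axisCusp N a b) = z * u') : u' ≤ 1 / 2 := by
  have hpos : 0 < minusPeriod f := IsNewform0.minusPeriod_pos_holds hf hQ
  have him : imagPeriods f = AddSubgroup.zmultiples (minusPeriod f / 2) := by
    rcases minusPeriod_eq_zero_or f with h | ⟨-, h⟩
    · exact absurd h hpos.ne'
    · exact h
  -- `Ω⁻/2 ∈ im Λ_f`: pick a period with that imaginary part
  have hhalf : minusPeriod f / 2 ∈ imagPeriods f := by rw [him]; exact AddSubgroup.mem_zmultiples _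
  unfold imagPeriods at hhalf
  obtain ⟨x, hx, hxim⟩ := AddSubgroup.mem_map.mp hhalf
  obtain ⟨z, hz⟩ := im_eq_zsmul_of_axis_unit hf hQ hu' hx
  have hxim' : x.im = minusPeriod f / 2 := hxim
  rw [hxim'] at hz
  -- `1/2 = z * u'` in `ℝ`, hence in `ℚ`
  have h1 : (1 / 2 : ℝ) = (z : ℝ) * (u' : ℝ) := by
    have h' : ((1 / 2 : ℝ) - (z : ℝ) * (u' : ℝ)) * minusPeriod f = 0 := by linear_combination hz
    rcases mul_eq_zero.mp h' with h0 | h0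
    · linarith
    · exact absurd h0 hpos.ne'
  have h1q : (1 / 2 : ℚ) = (z : ℚ) * u' := by
    have : ((1 / 2 : ℚ) : ℝ) = (((z : ℚ) * u' : ℚ) : ℝ) := by push_cast; exact h1
    exact Rat.cast_injective this
  have hzpos : 0 < (z : ℚ) := by
    by_contra hle
    have : (z : ℚ) * u' ≤ 0 := mul_nonpos_of_nonpos_of_nonneg (not_lt.mp hle) hu'pos.le
    linarith
  have hz0 : (0 : ℤ) < z := by exact_mod_cast hzpos
  have hz1 : (1 : ℚ) ≤ z := by exact_mod_cast (show (1 : ℤ) ≤ z by omega)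
  have hmul := mul_le_mul_of_nonneg_right hz1 hu'pos.le
  linarith

/-- **The minus period unit is unique** (two maximal common divisors bound each other). [folklore] -/
theorem isMinusPeriodUnit_unique {N : ℕ} (f : CuspForm (Gamma0 N) 2) {u u' : ℚ} (hu : IsMinusPeriodUnit f u) (hu' : IsMinusPeriodUnit f u') :
    u = u' :=
  le_antisymm (hu'.2.2 u hu.1 hu.2.1) (hu.2.2 u' hu'.1 hu'.2.1)

/-! ### §2 AN-34l″ and AN-34l′ -/

/-- **AN-34l″ `MinusPeriodUnitIsHalf` IS A THEOREM (body VERBATIM from REF1 §145 / `Probe145.lean` as the type): for every rational newform `f` of level `N`,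
`½` is THE minus period unit** — every axis cusp symbol `[−a/(Nb)]⁻_f` is a multiple of `½` (§1, Manin's homomorphism into `Λ_f` and `im Λ_f = ℤ·Ω⁻_f/2`),
and `½` is the largest such (the axis cusp symbols generate `im Λ_f`).  UNCONDITIONAL (Eichler–Shimura/Manin facts are tree theorems); BSD is not proved by
this. [cite: Manin1972, Prop. 1.4 and Thm. 1.9] [cite: CremonaAlgorithms1997, §2.8] -/
theorem minusPeriodUnitIsHalf :
    ∀ (N : ℕ) [NeZero N] (f : CuspForm (Gamma0 N) 2), IsNewform0 f → coeffField f = ⊥ → IsMinusPeriodUnit f (1 / 2) := by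
  intro N _ f hf hQ
  refine ⟨by norm_num, fun a b hb hab => ?_, fun u' hu'pos hu' => le_half_of_axis_unit hf hQ hu'pos hu'⟩
  obtain ⟨z, hz⟩ := exists_int_ratMinusSymbol_axisCusp_eq_div_two hf hQ hb hab
  exact ⟨z, by rw [hz]; ring⟩

/-- **AN-34l′ `MinusPeriodUnitEqHalf` IS A THEOREM (body VERBATIM from -an's `g17/Sketch_v50.lean` §20.5 as the type): every minus period unit of a rational
newform equals `½`** (AN-34l″ and uniqueness).  This is the unit transport of the glue v50 `EtaOneReductionAtTwo`: (HS)/AN-34f are stated in period units `u`,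
AN-33c is PROVED for the unit `½` (`isMinusSymbolUnitAway_half`, `minusHalfSumProportionality`).  UNCONDITIONAL; BSD is not proved by this.
[cite: Manin1972, Prop. 1.4 and Thm. 1.9] [cite: CremonaAlgorithms1997, §2.8] -/
theorem minusPeriodUnitEqHalf :
    ∀ (N : ℕ) [NeZero N] (f : CuspForm (Gamma0 N) 2), IsNewform0 f → coeffField f = ⊥ →
      ∀ (u : ℚ), IsMinusPeriodUnit f u → u = 1 / 2 :=
  fun N _ f hf hQ _ hu => isMinusPeriodUnit_unique f hu (minusPeriodUnitIsHalf N f hf hQ)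

end Summit.BirchSwinnertonDyer.BirchSwinnertonDyer.Theorems.RankOneAtTwoOneDoor

end
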